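/-
Copyright (c) 2026 the pub-hodgecm-mathlib formalisation cell (harness21).  Prover seat hodgecm-mathlib-R90-C131-p05 (g2), R90-TF SLAB section S4
«Ch13.1–2» (base R90-C131), h413 = `stmt-HodgeConjecture-24833`; brick (DICT)(1) F4 FILE A (S4 dealer K2E2-plan (g7), R90 bus 2026-09-05T01:10:20Z ∕ 01:11:05Z;
census 01:20:55Z).
-/
import Summits.HodgeConjecture.HodgeConjecture.Theorems.F0P3cStCharTSWeylHypFibre        -- ★ p849559 (LH2-p01): `mem_torusU_iff_forall_apply_eq_zero`, `isUnit_sub_of_isRegularElt_glDiagonal`; brings `torusU`, `IsRegularElt`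
import HarnessLib

/-!
# R90-TF · S4 — (DICT)(1) F4 FILE A `R90S4DiagFormTorusNormaliser`: the normaliser of the diagonal torus `T = torusU σ J` of `U(σ, J)(R)` consists of the MONOMIAL
# elements, and `N(T) ∕ T` embeds in the symmetric group (Rogawski 1990, §3.7 Prop. 3.7.1 pp. 29–30, §12.5 p. 182; Springer LAG 7.1.5)

Cell `hodgecm-mathlib`, crux H413 = `stmt-HodgeConjecture-24833`, route of record `HCCMUnconditional`; R90-TF section S4 (Rogawski Ch. 13.1–2, base `R90-C131`), seat
R90-C131-p05 (g2); brick F4 «`[N_U(T) : T] = 6 ∕ 2` at type (1)» of the stable transport dictionary (DICT)(1) (R90-C131-p01's census `CENSUS-DICT1-E1cubed.md`), FILE A of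
three.  THEOREMS ONLY (no `def`, no `instance`, no notation, no named-fact hypothesis, no `sorry`; default heartbeats); ★-only imports; lane `--supports
stmt-HodgeConjecture-24833 --as helper` (count-neutral).

THE MATHEMATICS.  `R` a commutative ring with a ring endomorphism `σ`, `J ∈ M_N(R)` ANY form, `U = U(σ, J)(R) = {g : ᵗ(σ g) J g = J}` (★ `unitaryGroupOfForm σ J`),
`T = torusU σ J ≤ U` its diagonal subgroup (★ `UnitaryGroup.torusU`).  A matrix `G` is `π`-MONOMIAL (`π` a permutation of `Fin N`) when `G_{j i} = 0` unless `j = π i`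
(column `i` is supported on row `π i`; no `def` — the predicate is spelled out).
* §1 MONOMIAL CALCULUS (plain matrices): `π`-monomial × `ρ`-monomial is `π ρ`-monomial with `(G H)_{j i} = G_{j, ρ i} H_{ρ i, i}` (`monomial_mul_apply`, `monomial_mul`); the
  inverse of an invertible `π`-monomial matrix is `π⁻¹`-monomial and its column entries `G_{π i, i}` are units (`monomial_inv`); the permutation of an invertible monomial matrix
  is unique over a non-trivial ring (`perm_unique_of_monomial`); diagonal = `1`-monomial (`monomial_one_iff`).
* §2 `N_U(T)` (ANY `J`): a monomial element of `U` normalises `T` (`mem_normalizer_torusU_of_monomial`: monomials conjugate diagonals to diagonals, §1); conversely, over a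
  FIELD-LIKE non-trivial `R` (every non-zero element a unit — the local field `L_w` at a non-split place) and given a REGULAR element `m = diag(d) ∈ T` (the `hR`, `hex` letters
  of ★ (A2) `F0P3cStCharTSWeylHypNormaliser.mem_normalizer_torusU_antidiag_three_iff`), every `g ∈ N_U(T)` is monomial (`exists_perm_monomial_of_mem_normalizer_torusU`): with
  `m′ = g⁻¹ m g = diag(d′) ∈ T`, `G · diag(d′) = diag(d) · G` gives `G_{j i}(d′_i − d_j) = 0`, and `d, d′` have unit differences, so every row and column of `G` carries exactly
  one non-zero entry (★ (A2)'s argument, verbatim up to the form).  Hence `mem_normalizer_torusU_iff_exists_perm`.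
* §3 THE WEYL HOMOMORPHISM (existence form, no `def`): there is `φ : N_U(T) →* Perm(Fin N)` with every `n` `φ(n)`-monomial and `ker φ = T` (`exists_monoidHom_perm_normalizer_torusU`);
  consequently **`[N_U(T) : T] = #{π ∈ Perm(Fin N) : some element of U is π-monomial}`** (`index_torusU_subgroupOf_normalizer_eq_natCard`, via `Subgroup.index_ker`) — the
  realisable permutations.  For `J = Φ₃` these are `{1, (0 2)}` (★ (A2), index `2`); FILE B computes them for a DIAGONAL form `J = diag(a)`: `π` is realisable iff
  `a_{π i} ∕ a_i` is a `σ`-norm for every `i`, whence `[N_U(T) : T] = 6` (all line classes equal) or `2` (mixed) at rank `3`; FILE C transports to `T = Z_{U(Φ)}(γ₀)` of type (1)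
  along an orthogonal eigenframe.

HONEST LABEL: HC_CM is proved only modulo the 7 printed citations (2 remaining named inputs: hLiu418 = `stmt-HodgeConjecture-24832`, h413 = `stmt-HodgeConjecture-24833`) until
rung 0 closes; F4 is an input of clause (C) of (DICT)(1) behind ★ (B2-S) behind the OPEN (W-NP) socket — a ★ helper closes no socket; REL ≠ ★ ≠ BUILT; count-neutral.

## References
* [Rogawski1990] J. D. Rogawski, *Automorphic Representations of Unitary Groups in Three Variables*, Ann. of Math. Stud. 123 (1990), §3.7 Prop. 3.7.1 pp. 29–30 (Weyl groups `Ω(T,G)`; for `p`-adic `F` the two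
  type-(1) classes `T₁, T₂` with `Ω(T₁,G) = S₃`, `Ω(T₂,G) = ℤ∕2`), §3.6 pp. 28–29 (Cartan subgroups of unitary groups), §12.5 p. 182 (the Weyl integration formula constants).
* [SpringerLAG1998] T. A. Springer, *Linear Algebraic Groups*, 2nd ed. (1998), 7.1.5 (normaliser of the diagonal torus = monomial matrices).
-/

set_option autoImplicit false
-- the mandated namespace repeats the single-problem summit's segment (`HodgeConjecture.HodgeConjecture`)
set_option linter.dupNamespace false

open Matrix
open Literature.NumberTheory.Automorphic Literature.NumberTheory.Automorphic.UnitaryGroup Literature.NumberTheory.Rogawski1990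
open Summit.HodgeConjecture.HodgeConjecture.Cruxes.H413.F0P3cStCharTSWeylHypFibre
open scoped MatrixGroups

namespace Summit.HodgeConjecture.HodgeConjecture.R90.S4

/-! ## §1 Monomial matrices -/

section Monomial

variable {R : Type*} [CommRing R] {N : ℕ}

/-- Entry formula for a product of monomial matrices: if `G` is `π`-monomial and `H` is `ρ`-monomial then `(G H)_{j i} = G_{j, ρ i} · H_{ρ i, i}`. [cite: SpringerLAG1998, 7.1.5] -/
theorem monomial_mul_apply {G H : Matrix (Fin N) (Fin N) R} {ρ : Equiv.Perm (Fin N)} (hH : ∀ i j, j ≠ ρ i → H j i = 0) (j i : Fin N) :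
    (G * H) j i = G j (ρ i) * H (ρ i) i := by
  rw [Matrix.mul_apply]
  exact Finset.sum_eq_single (ρ i) (fun l _ hl => by rw [hH i l hl, mul_zero]) fun h => absurd (Finset.mem_univ _) h

/-- The product of a `π`-monomial and a `ρ`-monomial matrix is `π ρ`-monomial. [cite: SpringerLAG1998, 7.1.5] -/
theorem monomial_mul {G H : Matrix (Fin N) (Fin N) R} {π ρ : Equiv.Perm (Fin N)} (hG : ∀ i j, j ≠ π i → G j i = 0) (hH : ∀ i j, j ≠ ρ i → H j i = 0) :
    ∀ i j, j ≠ (π * ρ) i → (G * H) j i = 0 := by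
  intro i j hj
  rw [monomial_mul_apply hH, hG (ρ i) j (by rwa [Equiv.Perm.mul_apply] at hj), zero_mul]

/-- A diagonal matrix is `1`-monomial and conversely: `G` is `1`-monomial iff all its off-diagonal entries vanish. [cite: SpringerLAG1998, 7.1.5] -/
theorem monomial_one_iff (G : Matrix (Fin N) (Fin N) R) : (∀ i j, j ≠ (1 : Equiv.Perm (Fin N)) i → G j i = 0) ↔ ∀ i j : Fin N, i ≠ j → G i j = 0 :=
  ⟨fun h i j hij => h j i (by rw [Equiv.Perm.one_apply]; exact hij), fun h i j hj => h j i (by rw [Equiv.Perm.one_apply] at hj; exact hj)⟩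

/-- **The inverse of an invertible monomial matrix**: if `G` is `π`-monomial and `G′ G = 1` then `G′_{i, π i} · G_{π i, i} = 1` for every `i` (the column entries of `G` are units)
and `G′` is `π⁻¹`-monomial. [cite: SpringerLAG1998, 7.1.5] -/
theorem monomial_inv {G G' : Matrix (Fin N) (Fin N) R} {π : Equiv.Perm (Fin N)} (hG : ∀ i j, j ≠ π i → G j i = 0) (h : G' * G = 1) :
    (∀ i, G' i (π i) * G (π i) i = 1) ∧ ∀ k j, j ≠ π⁻¹ k → G' j k = 0 := by
  have h1 : ∀ i, G' i (π i) * G (π i) i = 1 := fun i => by rw [← monomial_mul_apply hG, h, Matrix.one_apply_eq]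
  refine ⟨h1, fun k j hj => ?_⟩
  have hu : IsUnit (G (π (π⁻¹ k)) (π⁻¹ k)) := IsUnit.of_mul_eq_one_right _ (h1 (π⁻¹ k))
  have e : G' j (π (π⁻¹ k)) * G (π (π⁻¹ k)) (π⁻¹ k) = 0 := by rw [← monomial_mul_apply hG, h, Matrix.one_apply_ne hj]
  have hk : π (π⁻¹ k) = k := π.apply_symm_apply k
  rw [hk] at e hu
  exact (hu.mul_left_eq_zero).1 e

/-- The column entries `G_{π i, i}` of an invertible `π`-monomial matrix are units. [cite: SpringerLAG1998, 7.1.5] -/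
theorem isUnit_apply_perm_of_monomial {G G' : Matrix (Fin N) (Fin N) R} {π : Equiv.Perm (Fin N)} (hG : ∀ i j, j ≠ π i → G j i = 0) (h : G' * G = 1) (i : Fin N) :
    IsUnit (G (π i) i) :=
  IsUnit.of_mul_eq_one_right _ ((monomial_inv hG h).1 i)

/-- **Uniqueness of the permutation** of an invertible monomial matrix over a non-trivial ring. [cite: SpringerLAG1998, 7.1.5] -/
theorem perm_unique_of_monomial [Nontrivial R] {G G' : Matrix (Fin N) (Fin N) R} {π π' : Equiv.Perm (Fin N)} (hG : ∀ i j, j ≠ π i → G j i = 0)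
    (hG' : ∀ i j, j ≠ π' i → G j i = 0) (h : G' * G = 1) : π = π' := by
  ext i
  by_contra hne
  exact (isUnit_apply_perm_of_monomial hG h i).ne_zero (hG' i (π i) (fun e => hne (by rw [e])))

/-- Conjugating a diagonal matrix by an invertible monomial matrix gives a diagonal matrix: `G · C · G′` is `1`-monomial for `G` `π`-monomial, `C` diagonal, `G′ G = 1`.
[cite: SpringerLAG1998, 7.1.5] -/
theorem monomial_mul_diag_mul_inv {G G' C : Matrix (Fin N) (Fin N) R} {π : Equiv.Perm (Fin N)} (hG : ∀ i j, j ≠ π i → G j i = 0) (h : G' * G = 1)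
    (hC : ∀ i j : Fin N, i ≠ j → C i j = 0) : ∀ i j : Fin N, i ≠ j → (G * C * G') i j = 0 := by
  have hC1 := (monomial_one_iff C).2 hC
  have hprod := monomial_mul (monomial_mul hG hC1) (monomial_inv hG h).2
  rw [mul_one, mul_inv_cancel] at hprod
  exact (monomial_one_iff _).1 hprod

/-- Conjugating a diagonal matrix by the inverse of an invertible monomial matrix gives a diagonal matrix: `G′ · C · G` is `1`-monomial. [cite: SpringerLAG1998, 7.1.5] -/
theorem inv_mul_diag_mul_monomial {G G' C : Matrix (Fin N) (Fin N) R} {π : Equiv.Perm (Fin N)} (hG : ∀ i j, j ≠ π i → G j i = 0) (h : G' * G = 1)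
    (hC : ∀ i j : Fin N, i ≠ j → C i j = 0) : ∀ i j : Fin N, i ≠ j → (G' * C * G) i j = 0 := by
  have hC1 := (monomial_one_iff C).2 hC
  have hprod := monomial_mul (monomial_mul (monomial_inv hG h).2 hC1) hG
  rw [mul_one, inv_mul_cancel] at hprod
  exact (monomial_one_iff _).1 hprod

end Monomial

/-! ## §2 The normaliser of the diagonal torus of `U(σ, J)(R)` is the set of its monomial elements -/

section Normaliser

variable {R : Type*} [CommRing R] (σ : R →+* R) {N : ℕ} (J : Matrix (Fin N) (Fin N) R)

/-- **Monomial elements of `U(σ, J)` normalise the diagonal torus** (any form `J`, any commutative ring): conjugation by a monomial matrix and by its inverse preserve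
diagonality (§1). [cite: Rogawski1990, §3.7 Prop. 3.7.1 p. 29] [cite: SpringerLAG1998, 7.1.5] -/
theorem mem_normalizer_torusU_of_monomial (g : ↥(unitaryGroupOfForm σ J)) {π : Equiv.Perm (Fin N)}
    (hg : ∀ i j, j ≠ π i → ((g : GL (Fin N) R) : Matrix (Fin N) (Fin N) R) j i = 0) :
    g ∈ Subgroup.normalizer (torusU σ J : Set ↥(unitaryGroupOfForm σ J)) := by
  set G : Matrix (Fin N) (Fin N) R := ((g : GL (Fin N) R) : Matrix (Fin N) (Fin N) R) with hGdef
  set G' : Matrix (Fin N) (Fin N) R := (((g : GL (Fin N) R)⁻¹ : GL (Fin N) R) : Matrix (Fin N) (Fin N) R) with hG'def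
  have hG'G : G' * G = 1 := by rw [hGdef, hG'def, ← Units.val_mul, inv_mul_cancel, Units.val_one]
  rw [Subgroup.mem_normalizer_iff]
  intro t
  constructor
  · intro ht
    have htd := (mem_torusU_iff_forall_apply_eq_zero σ J t).1 ht
    refine (mem_torusU_iff_forall_apply_eq_zero σ J _).2 fun i j hij => ?_
    rw [Subgroup.coe_mul, Subgroup.coe_mul, Subgroup.coe_inv, Units.val_mul, Units.val_mul]
    exact monomial_mul_diag_mul_inv hg hG'G htd i j hij
  · intro hconj
    have hcd := (mem_torusU_iff_forall_apply_eq_zero σ J _).1 hconj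
    have e1 : t = g⁻¹ * (g * t * g⁻¹) * g := by group
    refine (mem_torusU_iff_forall_apply_eq_zero σ J t).2 fun i j hij => ?_
    rw [e1, Subgroup.coe_mul, Subgroup.coe_mul, Subgroup.coe_inv, Units.val_mul, Units.val_mul]
    exact inv_mul_diag_mul_monomial hg hG'G hcd i j hij

/-- **Every element of `N_U(T)` is monomial** over a field-like non-trivial `R` when `T` contains a regular element (★ (A2)'s argument for an arbitrary form `J`): with
`m = diag(d) ∈ T` regular and `m′ = g⁻¹ m g = diag(d′) ∈ T`, the relation `G · diag(d′) = diag(d) · G` reads `G_{j i}(d′_i − d_j) = 0`; unit differences of `d` and of `d′`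
leave exactly one non-zero entry in every row and every column. [cite: Rogawski1990, §12.5 p. 182; §3.7 Prop. 3.7.1 p. 29] [cite: SpringerLAG1998, 7.1.5] -/
theorem exists_perm_monomial_of_mem_normalizer_torusU [Nontrivial R] (hR : ∀ x : R, x ≠ 0 → IsUnit x)
    (hex : ∃ m : ↥(unitaryGroupOfForm σ J), m ∈ torusU σ J ∧ IsRegularElt (m : GL (Fin N) R))
    {g : ↥(unitaryGroupOfForm σ J)} (hg : g ∈ Subgroup.normalizer (torusU σ J : Set ↥(unitaryGroupOfForm σ J))) :
    ∃ π : Equiv.Perm (Fin N), ∀ i j, j ≠ π i → ((g : GL (Fin N) R) : Matrix (Fin N) (Fin N) R) j i = 0 := by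
  classical
  set G : Matrix (Fin N) (Fin N) R := ((g : GL (Fin N) R) : Matrix (Fin N) (Fin N) R) with hG
  set G' : Matrix (Fin N) (Fin N) R := (((g : GL (Fin N) R)⁻¹ : GL (Fin N) R) : Matrix (Fin N) (Fin N) R) with hG'
  have hGG' : G * G' = 1 := by rw [hG, hG', ← Units.val_mul, mul_inv_cancel, Units.val_one]
  have hG'G : G' * G = 1 := by rw [hG, hG', ← Units.val_mul, inv_mul_cancel, Units.val_one]
  -- the regular diagonal element and its conjugate
  obtain ⟨m, hmT, hmreg⟩ := hex
  obtain ⟨d, hd⟩ := hmT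
  have hd' : glDiagonal N R d = (m : GL (Fin N) R) := by rw [hd, Subgroup.coe_subtype]
  have hm'T : g⁻¹ * m * g ∈ torusU σ J := (Subgroup.mem_normalizer_iff''.1 hg m).1 ⟨d, hd⟩
  obtain ⟨d', hdd'⟩ := hm'T
  have hd'' : glDiagonal N R d' = ((g⁻¹ * m * g : ↥(unitaryGroupOfForm σ J)) : GL (Fin N) R) := by rw [hdd', Subgroup.coe_subtype]
  -- unit differences for `d` and `d′`
  have hregd : ∀ i j : Fin N, i ≠ j → IsUnit ((d i : R) - d j) := fun i j hij =>
    isUnit_sub_of_isRegularElt_glDiagonal (by rw [hd']; exact hmreg) hij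
  have hregd' : ∀ i j : Fin N, i ≠ j → IsUnit ((d' i : R) - d' j) := fun i j hij => by
    refine isUnit_sub_of_isRegularElt_glDiagonal ?_ hij
    rw [hd'', Subgroup.coe_mul, Subgroup.coe_mul, Subgroup.coe_inv]
    have e : ((g : GL (Fin N) R))⁻¹ * (m : GL (Fin N) R) * (g : GL (Fin N) R) =
        ((g : GL (Fin N) R))⁻¹ * (m : GL (Fin N) R) * (((g : GL (Fin N) R))⁻¹)⁻¹ := by rw [inv_inv]
    rw [e, isRegularElt_conj_iff]
    exact hmreg
  -- the relation `G · diag(d′) = diag(d) · G`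
  have hmat : ((m : GL (Fin N) R) : Matrix (Fin N) (Fin N) R) = diagonal fun k => (d k : R) := by rw [← hd', coe_glDiagonal]
  have hmat' : G' * (diagonal fun k => (d k : R)) * G = diagonal fun k => (d' k : R) := by
    have h := congrArg (fun x : GL (Fin N) R => (x : Matrix (Fin N) (Fin N) R)) hd''
    rw [coe_glDiagonal, Subgroup.coe_mul, Subgroup.coe_mul, Subgroup.coe_inv, Units.val_mul, Units.val_mul, hmat] at h
    exact h.symm
  have hrel : G * (diagonal fun k => (d' k : R)) = (diagonal fun k => (d k : R)) * G := by
    rw [← hmat', ← Matrix.mul_assoc, ← Matrix.mul_assoc, hGG', Matrix.one_mul]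
  have key : ∀ i j : Fin N, G i j ≠ 0 → (d i : R) = d' j := by
    intro i j hij
    have e := congrFun (congrFun hrel i) j
    rw [mul_diagonal, diagonal_mul] at e
    have e2 : G i j * ((d' j : R) - d i) = 0 := by rw [mul_sub, e]; ring
    exact (sub_eq_zero.1 (((hR _ hij).mul_right_eq_zero).1 e2)).symm
  have rowuniq : ∀ i j k : Fin N, G i j ≠ 0 → G i k ≠ 0 → j = k := by
    intro i j k hj hk
    by_contra hjk
    have hu := hregd' j k hjk
    rw [← key i j hj, ← key i k hk, sub_self] at hu
    exact not_isUnit_zero hu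
  have coluniq : ∀ i i' j : Fin N, G i j ≠ 0 → G i' j ≠ 0 → i = i' := by
    intro i i' j hi hi'
    by_contra hii
    have hu := hregd i i' hii
    rw [key i j hi, key i' j hi', sub_self] at hu
    exact not_isUnit_zero hu
  have colex : ∀ i : Fin N, ∃ j, G j i ≠ 0 := by
    intro i
    by_contra h
    push Not at h
    have e := congrFun (congrFun hG'G i) i
    rw [Matrix.mul_apply, Matrix.one_apply_eq, Finset.sum_eq_zero (fun k _ => by rw [h k, mul_zero])] at e
    exact zero_ne_one e
  -- the permutation: column `i` is supported on the row `π i`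
  choose π hπ using colex
  have hinj : Function.Injective π := fun i i' h => rowuniq (π i) i i' (hπ i) (h ▸ hπ i')
  refine ⟨Equiv.ofBijective π (Finite.injective_iff_bijective.1 hinj), fun i j hj => ?_⟩
  by_contra hji
  exact hj (coluniq j (π i) i hji (hπ i))

/-- **`g ∈ N_U(T)` iff the matrix of `g` is monomial** (field-like non-trivial `R`, a regular element in `T`; any form `J`).  For `J = Φ₃` unitarity leaves only the diagonal
and the anti-diagonal pattern (★ (A2)); for a diagonal form see FILE B. [cite: Rogawski1990, §12.5 p. 182; §3.7 Prop. 3.7.1 p. 29] [cite: SpringerLAG1998, 7.1.5] -/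
theorem mem_normalizer_torusU_iff_exists_perm [Nontrivial R] (hR : ∀ x : R, x ≠ 0 → IsUnit x)
    (hex : ∃ m : ↥(unitaryGroupOfForm σ J), m ∈ torusU σ J ∧ IsRegularElt (m : GL (Fin N) R)) (g : ↥(unitaryGroupOfForm σ J)) :
    g ∈ Subgroup.normalizer (torusU σ J : Set ↥(unitaryGroupOfForm σ J)) ↔
      ∃ π : Equiv.Perm (Fin N), ∀ i j, j ≠ π i → ((g : GL (Fin N) R) : Matrix (Fin N) (Fin N) R) j i = 0 :=
  ⟨exists_perm_monomial_of_mem_normalizer_torusU σ J hR hex, fun ⟨_, hπ⟩ => mem_normalizer_torusU_of_monomial σ J g hπ⟩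

/-- An element of `U` is in the torus iff its matrix is `1`-monomial. [cite: Rogawski1990, §1.10 p. 9] -/
theorem mem_torusU_iff_monomial_one (g : ↥(unitaryGroupOfForm σ J)) :
    g ∈ torusU σ J ↔ ∀ i j, j ≠ (1 : Equiv.Perm (Fin N)) i → ((g : GL (Fin N) R) : Matrix (Fin N) (Fin N) R) j i = 0 := by
  rw [mem_torusU_iff_forall_apply_eq_zero, monomial_one_iff]

end Normaliser

/-! ## §3 The Weyl homomorphism `N_U(T) → Perm(Fin N)` and the index formula -/

section Weyl

variable {R : Type*} [CommRing R] (σ : R →+* R) {N : ℕ} (J : Matrix (Fin N) (Fin N) R)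

/-- **The Weyl homomorphism** (existence form): over a field-like non-trivial `R` with a regular element in `T`, there is a group homomorphism `φ : N_U(T) →* Perm(Fin N)`
such that every `n ∈ N_U(T)` is `φ(n)`-monomial, and `ker φ = T`.  (`φ(n)` = the permutation of the eigenlines; multiplicativity is `monomial_mul` + uniqueness.)
[cite: Rogawski1990, §3.7 Prop. 3.7.1 p. 29; §12.5 p. 182] [cite: SpringerLAG1998, 7.1.5] -/
theorem exists_monoidHom_perm_normalizer_torusU [Nontrivial R] (hR : ∀ x : R, x ≠ 0 → IsUnit x)
    (hex : ∃ m : ↥(unitaryGroupOfForm σ J), m ∈ torusU σ J ∧ IsRegularElt (m : GL (Fin N) R)) :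
    ∃ φ : ↥(Subgroup.normalizer (torusU σ J : Set ↥(unitaryGroupOfForm σ J))) →* Equiv.Perm (Fin N),
      (∀ n i j, j ≠ φ n i → (((n : ↥(unitaryGroupOfForm σ J)) : GL (Fin N) R) : Matrix (Fin N) (Fin N) R) j i = 0) ∧
      φ.ker = (torusU σ J).subgroupOf (Subgroup.normalizer (torusU σ J : Set ↥(unitaryGroupOfForm σ J))) := by
  -- matrices and their inverses
  have hinv : ∀ g : ↥(unitaryGroupOfForm σ J),
      (((g : GL (Fin N) R)⁻¹ : GL (Fin N) R) : Matrix (Fin N) (Fin N) R) * ((g : GL (Fin N) R) : Matrix (Fin N) (Fin N) R) = 1 := fun g => by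
    rw [← Units.val_mul, inv_mul_cancel, Units.val_one]
  -- choose the permutation of every element of the normaliser
  choose f hf using fun n : ↥(Subgroup.normalizer (torusU σ J : Set ↥(unitaryGroupOfForm σ J))) =>
    exists_perm_monomial_of_mem_normalizer_torusU σ J hR hex n.2
  have hmul : ∀ a b, f (a * b) = f a * f b := fun a b => by
    have hab : ∀ i j, j ≠ (f a * f b) i → ((((a * b : ↥(Subgroup.normalizer (torusU σ J : Set ↥(unitaryGroupOfForm σ J)))) :
        ↥(unitaryGroupOfForm σ J)) : GL (Fin N) R) : Matrix (Fin N) (Fin N) R) j i = 0 := by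
      rw [Subgroup.coe_mul, Subgroup.coe_mul, Units.val_mul]
      exact monomial_mul (hf a) (hf b)
    exact perm_unique_of_monomial (hf (a * b)) hab (hinv _)
  refine ⟨MonoidHom.mk' f hmul, fun n => hf n, Subgroup.ext fun n => ?_⟩
  rw [MonoidHom.mem_ker, MonoidHom.mk'_apply, Subgroup.mem_subgroupOf, mem_torusU_iff_monomial_one]
  constructor
  · intro h1
    rw [← h1]
    exact hf n
  · intro hn
    exact perm_unique_of_monomial (hf n) hn (hinv _)

/-- **The index formula `[N_U(T) : T] = #{π : some element of U is π-monomial}`** (field-like non-trivial `R`, a regular element in `T`, any form `J`): the Weyl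
homomorphism has kernel `T` (`Subgroup.index_ker`) and its image is the set of permutations realised by a monomial element of `U` (such an element normalises `T`,
`mem_normalizer_torusU_of_monomial`). [cite: Rogawski1990, §3.7 Prop. 3.7.1 p. 29; §12.5 p. 182] [cite: SpringerLAG1998, 7.1.5] -/
theorem index_torusU_subgroupOf_normalizer_eq_natCard [Nontrivial R] (hR : ∀ x : R, x ≠ 0 → IsUnit x)
    (hex : ∃ m : ↥(unitaryGroupOfForm σ J), m ∈ torusU σ J ∧ IsRegularElt (m : GL (Fin N) R)) :
    ((torusU σ J).subgroupOf (Subgroup.normalizer (torusU σ J : Set ↥(unitaryGroupOfForm σ J)))).index =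
      Nat.card {π : Equiv.Perm (Fin N) // ∃ g : ↥(unitaryGroupOfForm σ J), ∀ i j, j ≠ π i → ((g : GL (Fin N) R) : Matrix (Fin N) (Fin N) R) j i = 0} := by
  obtain ⟨φ, hφ, hker⟩ := exists_monoidHom_perm_normalizer_torusU σ J hR hex
  have hinv : ∀ g : ↥(unitaryGroupOfForm σ J),
      (((g : GL (Fin N) R)⁻¹ : GL (Fin N) R) : Matrix (Fin N) (Fin N) R) * ((g : GL (Fin N) R) : Matrix (Fin N) (Fin N) R) = 1 := fun g => by
    rw [← Units.val_mul, inv_mul_cancel, Units.val_one]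
  rw [← hker, Subgroup.index_ker]
  refine Nat.card_congr (Equiv.subtypeEquivRight fun π => ?_)
  rw [MonoidHom.mem_range]
  constructor
  · rintro ⟨n, rfl⟩
    exact ⟨n, hφ n⟩
  · rintro ⟨g, hg⟩
    refine ⟨⟨g, mem_normalizer_torusU_of_monomial σ J g hg⟩, ?_⟩
    exact perm_unique_of_monomial (hφ _) hg (hinv g)

/-- **`[N_U(T) : T] ≠ 0`**: the Weyl group of the diagonal torus is finite (it embeds in `Perm(Fin N)`). [cite: Rogawski1990, §3.7 Prop. 3.7.1 p. 29] -/
theorem index_torusU_subgroupOf_normalizer_ne_zero [Nontrivial R] (hR : ∀ x : R, x ≠ 0 → IsUnit x)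
    (hex : ∃ m : ↥(unitaryGroupOfForm σ J), m ∈ torusU σ J ∧ IsRegularElt (m : GL (Fin N) R)) :
    ((torusU σ J).subgroupOf (Subgroup.normalizer (torusU σ J : Set ↥(unitaryGroupOfForm σ J)))).index ≠ 0 := by
  rw [index_torusU_subgroupOf_normalizer_eq_natCard σ J hR hex]
  haveI : Nonempty {π : Equiv.Perm (Fin N) // ∃ g : ↥(unitaryGroupOfForm σ J), ∀ i j, j ≠ π i → ((g : GL (Fin N) R) : Matrix (Fin N) (Fin N) R) j i = 0} :=
    ⟨⟨1, 1, fun i j hj => by rw [Subgroup.coe_one, Units.val_one]; exact Matrix.one_apply_ne (by rwa [Equiv.Perm.one_apply] at hj)⟩⟩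
  exact Nat.card_pos.ne'

/-- **`[N_U(T) : T] ≤ N!`**. [cite: Rogawski1990, §3.7 Prop. 3.7.1 p. 29] [cite: SpringerLAG1998, 7.1.5] -/
theorem index_torusU_subgroupOf_normalizer_le_factorial [Nontrivial R] (hR : ∀ x : R, x ≠ 0 → IsUnit x)
    (hex : ∃ m : ↥(unitaryGroupOfForm σ J), m ∈ torusU σ J ∧ IsRegularElt (m : GL (Fin N) R)) :
    ((torusU σ J).subgroupOf (Subgroup.normalizer (torusU σ J : Set ↥(unitaryGroupOfForm σ J)))).index ≤ N.factorial := by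
  classical
  rw [index_torusU_subgroupOf_normalizer_eq_natCard σ J hR hex, Nat.card_eq_fintype_card]
  calc Fintype.card {π : Equiv.Perm (Fin N) // ∃ g : ↥(unitaryGroupOfForm σ J), ∀ i j, j ≠ π i → ((g : GL (Fin N) R) : Matrix (Fin N) (Fin N) R) j i = 0}
      ≤ Fintype.card (Equiv.Perm (Fin N)) := Fintype.card_subtype_le _
    _ = N.factorial := by rw [Fintype.card_perm, Fintype.card_fin]

end Weyl

end Summit.HodgeConjecture.HodgeConjecture.R90.S4
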